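import Summits.CriticalPhenomena.SAWScalingLimit.Theses.SAWInfinitesimalRigidity
import Summits.CriticalPhenomena.SAWScalingLimit.Theorems.SAWInfinitesimalRigidityQuarterTurnSign
import Summits.CriticalPhenomena.SAWScalingLimit.Theorems.SAWLoopFugacityFlowAvoidanceDeterminesLaw
import Summits.CriticalPhenomena.SAWScalingLimit.Theorems.SAWLoopFugacityFlowSLECarrier
import Literature.Probability.RandomPlanarGeometry.ConformalRestrictionCovariance

/-!
# Line `birth` — checked BC3 skeleton for the crux `LocalRigidity`
# (stmt-CriticalPhenomena-4616, route `SAWInfinitesimalRigidity`, rank 2, sub-problem `SAWScalingLimit`)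

Crux (fixed, concluded BY NAME): `SAWInfinitesimalRigidity.LocalRigidity` — for every chordal family
`F` all of whose laws are chordal SLE(8/3) laws there is `ε > 0` such that every chordal family `P`
with the lattice-EXACT axioms (chordal, two-sided restriction, restriction-coupled domain Markov
kernel, reversibility, covariance under `z ↦ r·iᵏ·z + w` and under conjugation, simple
boundary-avoiding curves) whose sub-domain avoidance probabilities are uniformly `ε`-close to those
of `F` is conformally covariant.

THE LINE is the route's own TWO-LAYER PLAN for this crux ("LocalRigidity ⇐ InfinitesimalRigidity →
ImplicitFunctionStep → LocalRigidity"), typed in the kinematic first-order calculus the tree already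
HAS for this route (`Theorems/SAWInfinitesimalRigidityDefs.lean`: the exact restriction–Markov class
`𝒱 = exactRestrictionMarkovClass`, its lattice-covariant part `latticeExactClass`, the graded
tangent space `restrictionMarkovTangentSpace y 𝒯 F = T_y(F)`, the stretch velocities = the image of
`sym₀(2)`, the avoidance observables = the coordinates of the closeness clause) and cut exactly where
the tree already PROVES the glue:

* `stub_IR0` (= the informal engine IR0, item stmt-CriticalPhenomena-5236, in the typed reading its
  definitions file announces; OPEN, size XL, load-bearing): for the SLE(8/3) family `F`, every
  dilation-weight-0 tangent vector at `F` of `𝒱` along the avoidance observables is a stretch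
  velocity — `T_0(F) ⊆ sym₀(2)`.
* PROVED GLUE (tree, `Theorems/SAWInfinitesimalRigidityQuarterTurnSign.lean`,
  `tangentCone_latticeExactClass_avoidance_subset`): IR0 ⇒ the tangent cone at `F` of the
  lattice-exact class along the avoidance observables is `{0}` — the quarter-turn of `ℤ²` acts by
  `−1` on `sym₀(2)` (Beffara's sign lemma), and velocities of curves of lattice-covariant families are
  weight 0 and quarter-turn covariant. This is "`H¹ = 0`", infinitesimal R*.
* `stub_isolation` (the IMPLICIT-FUNCTION STEP "infinitesimally rigid ⇒ locally rigid", Weil 1964 /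
  Nash–Moser shape; OPEN, size L–XL): if the tangent cone at the SLE(8/3) family `F` of the
  lattice-exact class along the avoidance observables is `{0}`, then `F` is ISOLATED in that class in
  the avoidance coordinates: there is `ε > 0` such that every `P ∈ latticeExactClass` that is
  conjugation covariant and `ε`-close to `F` in the sup-avoidance distance has EXACTLY the avoidance
  probabilities of `F` on every nested Dobrushin pair. (Kinematic cone, so the content is a
  curve-selection / closed-range statement: a non-isolated `F` must carry a `C¹`-along-avoidance
  deformation curve inside the class with non-zero velocity.)
* `LocalRigidity_of : Stubs.stub_IR0 → Stubs.stub_isolation → LocalRigidity` — PROVED (no `sorry`):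
  `stub_IR0` + the sign lemma give `H¹ = 0`; `stub_isolation` gives `ε` and, for an admissible
  `ε`-close `P` (which lies in `latticeExactClass` by `mem_latticeExactClass`), equality of all
  sub-domain avoidance probabilities with those of `F`; both `P D` and `F D` are probability laws
  carried by simple chords of `(D; a, b)` meeting `∂D` only at `a, b` (`P`: chordal + simplicity
  clauses; `F`: the PROVED `SLECarrier_proof`, Rohde–Schramm), so the PROVED identification theorem
  `AvoidanceDeterminesLaw_proof` (LSW03 Lemma 3.2 on simple chords, stmt-CriticalPhenomena-1373) gives
  `P D = F D` for every `D`, i.e. `P = F`; and a family of chordal SLE(8/3) laws is conformally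
  covariant (PROVED, `ChordalFamily.isConformallyCovariant_of_isSLELaw`, Lawler 2005 §6.1).

Why the stubs are not the crux / the summit in disguise: `stub_IR0` is a statement about first-order
deformations of ONE family inside the translation-covariant class `𝒱` (no `ε`, no `P`, no
conformal covariance); `stub_isolation` is CONDITIONAL on `H¹ = 0` (which only IR0 + the sign lemma
supply) and concludes avoidance equalities, not covariance (the identification and the covariance
of the SLE family are the proved theorems the assembly spends) — neither implies `LocalRigidity` or
`SAWScalingLimit` by `first | exact? | simpa | aesop` (BC3 probes `bc/probe_IR0.lean`,
`bc/probe_isolation.lean`: all FAIL as required).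

Disproof used: none relevant — no `Cruxes/LocalRigidity/Disproof.lean` and no `Negative/` lemma exist
at registration (`ledger crux ls stmt-CriticalPhenomena-4616`: no workfiles); `ledger negatives
--problem CriticalPhenomena` (11 entries, 2026-08-17): the only chordal-family negative is
stmt-CriticalPhenomena-0698 (`not_SymmetryUpgrade`, fat-germ one-shot surgery of the SLE₆ family —
similarity covariant, local, Markov, target independent). Neither stub is an instance: both live
inside the two-sided RESTRICTION class (`latticeExactClass ⊆ exactRestrictionMarkovClass`), which a
germ-keyed surgery leaves (restriction to a sub-domain whose boundary touches the inserted segment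
from the side is violated), and `stub_IR0` concerns tangent vectors, not families.
-/

noncomputable section

open MeasureTheory Filter Topology Set
open scoped NNReal ENNReal
open Literature.Probability.RandomPlanarGeometry
open Literature.Probability.RandomPlanarGeometry.ChordalFamily
open Summit.CriticalPhenomena.SAWScalingLimit.Theses.SAWInfinitesimalRigidity
open Summit.CriticalPhenomena.SAWScalingLimit.Theorems
open Summit.CriticalPhenomena.SAWScalingLimit.Theorems.InfinitesimalRigidity

namespace Summit.CriticalPhenomena.SAWScalingLimit.Cruxes.LocalRigidity.Birth

/-! ## The two registered stubs: precise `Prop`s `Stubs.stub_*` (hypotheses of `LocalRigidity_of`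
BY NAME) + the sorried theorems `stub_*` with the same statements spelled out over tree declarations -/

namespace Stubs

/-- **Stub `Prop` 1 (`IR0`, graded infinitesimal rigidity at weight 0; the engine, hardest).** For a
chordal family `F` all of whose laws are chordal SLE(8/3) laws, every dilation-invariant tangent
vector at `F` of the exact restriction–Markov class `𝒱` along the avoidance observables is a real
multiple of the velocity of a stretch curve `t ↦ (L_t^{(u)})_* F`: `T_0(F) ⊆ sym₀(2)`. -/
def stub_IR0 : Prop :=
  ∀ F : Literature.Probability.RandomPlanarGeometry.ChordalFamily, (∀ D : Literature.Probability.RandomPlanarGeometry.DobrushinDomain, Literature.Probability.RandomPlanarGeometry.IsSLELaw ((8 : NNReal) / 3) D (F D)) → Summit.CriticalPhenomena.SAWScalingLimit.Theorems.InfinitesimalRigidity.restrictionMarkovTangentSpace 0 Summit.CriticalPhenomena.SAWScalingLimit.Theorems.InfinitesimalRigidity.avoidanceObservables F ⊆ Summit.CriticalPhenomena.SAWScalingLimit.Theorems.InfinitesimalRigidity.stretchVelocities Summit.CriticalPhenomena.SAWScalingLimit.Theorems.InfinitesimalRigidity.avoidanceObservables F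

/-- **Stub `Prop` 2 (`isolation`, the implicit-function step "`H¹ = 0` ⇒ isolated").** If the tangent
cone at the SLE(8/3) family `F` of the lattice-exact class along the avoidance observables is `{0}`,
then there is `ε > 0` such that every conjugation-covariant `P ∈ latticeExactClass` whose sub-domain
avoidance probabilities are uniformly `ε`-close to those of `F` has exactly the avoidance
probabilities of `F` on every nested Dobrushin pair with the same marked points. -/
def stub_isolation : Prop :=
  ∀ F : Literature.Probability.RandomPlanarGeometry.ChordalFamily, (∀ D : Literature.Probability.RandomPlanarGeometry.DobrushinDomain, Literature.Probability.RandomPlanarGeometry.IsSLELaw ((8 : NNReal) / 3) D (F D)) → Literature.Probability.RandomPlanarGeometry.ChordalFamily.tangentCone Summit.CriticalPhenomena.SAWScalingLimit.Theorems.InfinitesimalRigidity.latticeExactClass F Summit.CriticalPhenomena.SAWScalingLimit.Theorems.InfinitesimalRigidity.avoidanceObservables ⊆ {0} → ∃ ε : ℝ, 0 < ε ∧ ∀ P : Literature.Probability.RandomPlanarGeometry.ChordalFamily, P ∈ Summit.CriticalPhenomena.SAWScalingLimit.Theorems.InfinitesimalRigidity.latticeExactClass → (∀ D : Literature.Probability.RandomPlanarGeometry.DobrushinDomain,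 P (D.map Complex.conjLIE.toHomeomorph) = (P D).map (Literature.Probability.RandomPlanarGeometry.CurveClass.map (Complex.conjLIE.toHomeomorph : C(ℂ, ℂ)))) → (∀ D D' : Literature.Probability.RandomPlanarGeometry.DobrushinDomain, D'.carrier ⊆ D.carrier → D'.pt 0 = D.pt 0 → D'.pt 1 = D.pt 1 → |(P D (Literature.Probability.RandomPlanarGeometry.CurveClass.rangeSubset (closure D'.carrier))).toReal - (F D (Literature.Probability.RandomPlanarGeometry.CurveClass.rangeSubset (closure D'.carrier))).toReal| ≤ ε) → ∀ D D' : Literature.Probability.RandomPlanarGeometry.DobrushinDomain, D'.carrier ⊆ D.carrier → D'.pt 0 = D.pt 0 → D'.pt 1 = D.pt 1 → P D (Literature.Probability.RandomPlanarGeometry.CurveClass.rangeSubset (closure D'.carrier)) = F D (Literature.Probability.RandomPlanarGeometry.CurveClass.rangeSubset (closure D'.carrier))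

end Stubs

/-- **Stub 1 (`IR0`; OPEN, hardest — `T_0(SLE(8/3)) ⊆ sym₀(2)`).** Attack (card / route header): the
linearised restriction identity makes a weight-0 tangent vector an ADDITIVE cocycle on nested pairs,
the linearised restriction-coupled Markov identity an integral equation through the Loewner
description of SLE(8/3) (restriction exponent `5/8`); translation + dilation invariance grade it, and
the claim is that its solution space is the 2-dimensional spin-±2 module spanned by the
infinitesimal stretches (Beffara's linear modulus). Why it might fail: an exotic weight-0
restriction–Markov cocycle at SLE(8/3) (`T_0` never computed; c = 0 log-partner / Jordan block).
[cite: LawlerSchrammWerner2003Restriction, Thm 6.1] [cite: Beffara2008Universal, §2.2 and Prop. 4]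
[cite: FriedrichWerner2003] [cite: Kytola2007] -/
theorem stub_IR0 : ∀ F : Literature.Probability.RandomPlanarGeometry.ChordalFamily, (∀ D : Literature.Probability.RandomPlanarGeometry.DobrushinDomain, Literature.Probability.RandomPlanarGeometry.IsSLELaw ((8 : NNReal) / 3) D (F D)) → Summit.CriticalPhenomena.SAWScalingLimit.Theorems.InfinitesimalRigidity.restrictionMarkovTangentSpace 0 Summit.CriticalPhenomena.SAWScalingLimit.Theorems.InfinitesimalRigidity.avoidanceObservables F ⊆ Summit.CriticalPhenomena.SAWScalingLimit.Theorems.InfinitesimalRigidity.stretchVelocities Summit.CriticalPhenomena.SAWScalingLimit.Theorems.InfinitesimalRigidity.avoidanceObservables F := by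
  sorry

/-- **Stub 2 (`isolation`; OPEN — the implicit-function step).** Attack: contrapositive curve
selection — if for every `ε` an admissible `P_ε ≠ F` (in avoidance coordinates) exists, build from
the restriction cocycles `f_ε(D;D') = P_ε D {γ ⊆ cl D'}` (multiplicative, translation/dilation/
quarter-turn covariant, `ε`-close to `Φ'^{5/8}`) a `C¹`-along-avoidance curve in the lattice-exact
class through `F` with non-zero velocity (compactness of normalised differences of additive
`log`-cocycles + closed range of the linearised restriction–Markov operator; Nash–Moser if
derivatives are lost), contradicting `H¹ = 0`. Why it might fail: the kinematic cone can vanish at a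
non-isolated point (cusp / accumulating isolated solutions); the sup-avoidance topology may lose
derivatives. [cite: Weil1964Rigidity] [cite: Hamilton1982NashMoser]
[cite: LawlerSchrammWerner2003Restriction, §3] -/
theorem stub_isolation : ∀ F : Literature.Probability.RandomPlanarGeometry.ChordalFamily, (∀ D : Literature.Probability.RandomPlanarGeometry.DobrushinDomain, Literature.Probability.RandomPlanarGeometry.IsSLELaw ((8 : NNReal) / 3) D (F D)) → Literature.Probability.RandomPlanarGeometry.ChordalFamily.tangentCone Summit.CriticalPhenomena.SAWScalingLimit.Theorems.InfinitesimalRigidity.latticeExactClass F Summit.CriticalPhenomena.SAWScalingLimit.Theorems.InfinitesimalRigidity.avoidanceObservables ⊆ {0} → ∃ ε : ℝ, 0 < ε ∧ ∀ P : Literature.Probability.RandomPlanarGeometry.ChordalFamily, P ∈ Summit.CriticalPhenomena.SAWScalingLimit.Theorems.InfinitesimalRigidity.latticeExactClass → (∀ D : Literature.Probability.RandomPlanarGeometry.DobrushinDomain, P (D.map Complex.conjLIE.toHomeomorph) = (P D).map (Literature.Probability.RandomPlanarGeometry.CurveClass.map (Complex.conjLIE.toHomeomorph : C(ℂ, ℂ))))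 → (∀ D D' : Literature.Probability.RandomPlanarGeometry.DobrushinDomain, D'.carrier ⊆ D.carrier → D'.pt 0 = D.pt 0 → D'.pt 1 = D.pt 1 → |(P D (Literature.Probability.RandomPlanarGeometry.CurveClass.rangeSubset (closure D'.carrier))).toReal - (F D (Literature.Probability.RandomPlanarGeometry.CurveClass.rangeSubset (closure D'.carrier))).toReal| ≤ ε) → ∀ D D' : Literature.Probability.RandomPlanarGeometry.DobrushinDomain, D'.carrier ⊆ D.carrier → D'.pt 0 = D.pt 0 → D'.pt 1 = D.pt 1 → P D (Literature.Probability.RandomPlanarGeometry.CurveClass.rangeSubset (closure D'.carrier)) = F D (Literature.Probability.RandomPlanarGeometry.CurveClass.rangeSubset (closure D'.carrier)) := by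
  sorry

/-! Consistency: each registered theorem statement IS the corresponding `Stubs` `Prop` (definitional). -/

example : Stubs.stub_IR0 := stub_IR0
example : Stubs.stub_isolation := stub_isolation

/-! ## The composition: the two stubs imply the crux (kernel-checked, no `sorry` of its own) -/

/-- **`LocalRigidity` from the two stubs.** Fix the SLE(8/3) family `F`. `stub_IR0` and the PROVED
quarter-turn sign lemma (`tangentCone_latticeExactClass_avoidance_subset`) give `H¹ = 0`: the tangent
cone at `F` of the lattice-exact class along the avoidance observables is `{0}`. `stub_isolation`
turns this into an `ε > 0`; an admissible `ε`-close `P` lies in `latticeExactClass`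
(`mem_latticeExactClass`), so its sub-domain avoidance probabilities are exactly those of `F`. Both
`P D` and `F D` are probability laws carried by the simple chords of `(D; a, b)` meeting `∂D` only at
`a, b` (`P`: its chordal and simplicity clauses; `F`: `SLECarrier_proof`), so
`AvoidanceDeterminesLaw_proof` (hull sub-domains are nested pairs) gives `P D = F D` for every `D`,
hence `P = F`, and the family of chordal SLE(8/3) laws is conformally covariant
(`isConformallyCovariant_of_isSLELaw`). [cite: LawlerSchrammWerner2003Restriction, Lemma 3.2]
[cite: Beffara2008Universal, Prop. 4] [cite: Lawler2005, §6.1 p. 149] -/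
theorem LocalRigidity_of : Stubs.stub_IR0 → Stubs.stub_isolation → LocalRigidity := by
  intro hIR hIso F hF
  -- H¹ = 0 at F (IR0 + the proved sign lemma), then the isolation radius ε
  obtain ⟨ε, hε, hiso⟩ := hIso F hF (tangentCone_latticeExactClass_avoidance_subset (hIR F hF))
  refine ⟨ε, hε, ?_⟩
  intro P hch hres hmk hrev hsim hconj hsimple hclose
  -- the admissible family lies in the lattice-exact class
  have hP : P ∈ latticeExactClass := mem_latticeExactClass hch hres hmk hrev hsim hsimple
  -- isolation: P has exactly the avoidance probabilities of F
  have havoid := hiso P hP hconj hclose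
  -- identification: laws on simple chords are determined by their avoidance probabilities
  have hPF : P = F := by
    funext D
    have hFc := SLECarrier_proof D (F D) (hF D)
    haveI : IsProbabilityMeasure (P D) := (hch D).1
    haveI : IsProbabilityMeasure (F D) := hFc.1
    refine AvoidanceDeterminesLaw.AvoidanceDeterminesLaw_proof D (P D) (F D) inferInstance
      inferInstance ?_ hFc.2 ?_
    · filter_upwards [(hch D).2, hsimple D] with γ h₁ h₂
      exact ⟨h₂.1, h₁.1, h₁.2.1, h₁.2.2, h₂.2⟩
    · intro D' hsub h0 h1 _
      exact havoid D D' hsub h0 h1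
  -- the family of chordal SLE(8/3) laws is conformally covariant
  rw [hPF]
  exact ChordalFamily.isConformallyCovariant_of_isSLELaw hF

/-- **The crux BY NAME, modulo exactly the two registered stubs** (§3.3 shape of the skeleton: the
line becomes the crux proof when the last `stub_*` is discharged; until then `closed = false` through
`sorryAx` in `stub_IR0`, `stub_isolation` and nothing else). -/
theorem LocalRigidity_proof : LocalRigidity :=
  LocalRigidity_of stub_IR0 stub_isolation

end Summit.CriticalPhenomena.SAWScalingLimit.Cruxes.LocalRigidity.Birth

end
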